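import Summits.BirchSwinnertonDyer.BirchSwinnertonDyer.Theorems.Rank2ObservatoryRank3Row0ByName
import Literature.NumberTheory.EllipticCurves.BSDSelmer
import Literature.NumberTheory.EllipticCurves.SelmerCorankHolds
import Literature.NumberTheory.EllipticCurves.IwasawaLeadingTermProofs
import HarnessLib

/-!
# BirchSwinnertonDyer — rank ≥ 2 observatory: rank-3 census — the Ш SIDE per row: `corank Sel_{p^∞} = 3 + corank Ш[p^∞] ≥ 3` at every prime (hypothesis-free) and, granting the `p`-parity theorem, `corank Ш(E/ℚ)[p^∞]` is EVEN at every prime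

HONEST FRAMING: per-curve certified theorems and census instruments; no claim on BSD in rank ≥ 2.
Nothing here proves BSD, or finiteness of Ш, for any curve.  Statements whose whole content is about
`Sel_{p^∞}(E/ℚ)` or `Ш(E/ℚ)[p^∞]` do not bear on `ord_{s=1} L(E,s) = rank_ℤ E(ℚ)` in rank `≥ 2`
(catalogued barrier `Literature/Barriers/BirchSwinnertonDyer/SelmerVersusMordellWeil`); this file records,
row by row, what the kernel census DOES say about the Tate–Shafarevich side, and names what it does not.

What the landed census (`Rank3KernelRankCensusN9375`: `rank_ℤ E(ℚ) = 3` in the kernel for 9 375 of the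
9 487 rank-3 rows, 2-descent certificates; the whole table granting `hup` for the 112 named residual rows)
gives on the Ш side, all pure glue BY NAME (no definitions, no data, no numerics, no `decide` on tables):

* §0/§1 **HYPOTHESIS-FREE, per row and every prime `p`:** `corank_{ℤ_p} Sel_{p^∞}(E/ℚ) = 3 + corank_{ℤ_p} Ш(E/ℚ)[p^∞]`,
  hence `corank Sel_{p^∞}(E/ℚ) ≥ 3` at EVERY prime, and `Ш(E/ℚ)[p^∞]` is finite `↔ corank Sel_{p^∞} = 3`
  — the kernel rank `3` fed into the tree THEOREM `WeierstrassCurve.selmerCorank_eq_mordellWeilRank_add_holds`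
  (Greenberg's corank identity `corank Sel_{p^∞} = rank + corank Ш[p^∞]`, discharged in the tree from the
  Kummer sequence, Mordell–Weil and AEC X.4.2(b)) and `finite_primaryComponent_sha_iff_shaCorank_eq_zero`.
* §0/§1 **GRANTING THE `p`-PARITY THEOREM** (`hpp : p_parity E p`, Dokchitser–Dokchitser 2010 Thm. 1.4:
  `(−1)^{corank Sel_{p^∞}(E/ℚ)} = w(E)` for every `E/ℚ` and every prime `p` — a theorem in print, a named
  fact in the tree) and the named local-root-number facts `hKD`, `hR` (which give `w(E) = −1` in the kernel,
  exactly as in `Rank2ObservatoryRank3ParityBSDPrediction`): `corank Sel_{p^∞}(E/ℚ)` is ODD, so — the rank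
  being `3` — **`corank_{ℤ_p} Ш(E/ℚ)[p^∞]` is EVEN: `Ш(E/ℚ)[p^∞]` is finite or has corank `≥ 2`**; the
  ALGEBRAIC DECISION WINDOW `Ш(E/ℚ)[p^∞]` finite `↔ corank Sel_{p^∞}(E/ℚ) ≤ 4` (`↔ = 3`), the exact
  Selmer-side twin of the analytic window `ord_{s=1} L ≤ 4 ↔ ord = 3` of `Rank2ObservatoryRank3AnalyticDecision`;
  and the tree's analytic `p`-parity fact `selmerCorank_mod_two_eq E p` (`corank Sel_{p^∞} ≡ ord_{s=1} L (mod 2)`)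
  DISCHARGED for these curves from `hpp` and the sign alone (both sides odd; no Gross–Zagier input).
  In Dokchitser's notation `Ш[p^∞] ≅ (ℚ_p/ℤ_p)^{δ_p} × (finite)`, `rk_p = rk + δ_p`: here `rk = 3` is a
  kernel theorem and `δ_p` is even for every `p`.
* §1 also: what the TWO clauses of full BSD say separately on a row — the summit statement
  (`BirchSwinnertonDyer`, rank part) gives `ord_{s=1} L(E,s) = 3 ≤ corank Sel_{p^∞}(E/ℚ)` with equality
  `↔ Ш(E/ℚ)[p^∞]` finite (the Shafarevich–Tate clause, NOT part of the summit statement).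
* §2 aggregated over the 9 375 pairwise distinct curves (`selmerCorank_rows9375`, hypothesis-free;
  `shaCorank_parity_rows9375`, granting `hKD`, `hR` and the `p`-parity theorem `hDD`).
* §3 row `0` by name (`Curve5077a.E = 5077a1`), sign from the Modularity Theorem (`Curve5077a.rootNumber_E`).

NOT in the kernel, and not claimed: `corank Ш(E/ℚ)[p^∞] = 0` itself for any row or prime (finiteness of
`Ш(E/ℚ)[p^∞]` in rank `3` is open in general; per curve, `δ_2 = 0` is being booked from the same 2-descent
certificates by route `ShaPrimaryTransfer`'s cells, and `δ_p = 0` at good ordinary `p` granting Kato /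
Perrin-Riou–Schneider / overconvergent-symbol inputs by the `p`-adic atlas `Rank2ObservatoryPadicAtlasR3*` —
neither is restated here); the order of the finite part of Ш; `#Ш_an`.

Inputs, all named: `hKD` [Kellock–Dokchitser 2023, Thm. 2.3 and §5] / `hR` [Rohrlich] (local root numbers =
the tree's tables); `hpp` / `hDD` [Dokchitser–Dokchitser 2010, Thm. 1.4] only where marked; `hmod`
(Modularity) in §3; `hBSD` (the summit statement, as a hypothesis) only in the one theorem reading BSD.
Sorry-free; no new axioms (`propext`, `Classical.choice`, `Quot.sound`).

References: T. Dokchitser, V. Dokchitser, *On the Birch–Swinnerton-Dyer quotients modulo squares*, Ann. of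
Math. 172 (2010) 567–596 (arXiv:math/0610290), Thm. 1.4 («Conjecture 1.2 [the `p`-parity conjecture] holds
for all `E/ℚ` and all primes `p`», p. 3 of the arXiv text); T. Dokchitser, *Notes on the parity conjecture*,
in: Elliptic curves, Hilbert modular forms and Galois deformations, Birkhäuser 2013 (arXiv:1009.5389), §2
(p. 4: `Ш[p^∞] ≅ (ℚ_p/ℤ_p)^{δ_p} ×` finite, `rk_p = rk + δ_p`; §1.1: finiteness of Ш `⇒` parity);
R. Greenberg, *Iwasawa theory for elliptic curves*, LNM 1716 (1999) 51–144, §1 pp. 54–57 (the corank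
identity); J. H. Silverman, AEC (2nd ed. 2009) Thm. X.4.2 and C.16 Thm. 16.3; J. S. Milne, *Arithmetic
Duality Theorems* (2nd ed. 2006) I.§6; L. C. Kellock, V. Dokchitser, *Root numbers and parity phenomena*,
Bull. LMS 55 (2023), Thm. 2.3 and §5; J. Buhler, B. Gross, D. Zagier, Math. Comp. 44 (1985) 473–481.
-/

-- single-conjunct summit: `Summit.BirchSwinnertonDyer.BirchSwinnertonDyer.…` repeats the name by design
set_option linter.dupNamespace false

namespace Summit.BirchSwinnertonDyer.BirchSwinnertonDyer.Rank2Observatory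

open Literature Literature.NumberTheory.EllipticCurves Literature.NumberTheory.EllipticCurves.ModularForms
open WeierstrassCurve
open Rank3CensusAudit (residualRows112 mem_rows9375_iff rank_eq_three_of_mem_rank3Table112)

/-! ### §0 Generic glue over `ℚ`: a curve with `rank_ℤ E(ℚ) = 3` (and, where marked, sign `−1` and `p`-parity) -/

/-- **Corank identity at rank 3** (hypothesis-free): `corank Sel_{p^∞}(E/ℚ) = 3 + corank Ш(E/ℚ)[p^∞]`.
[cite: Greenberg1999LNM, §1 pp. 54–57] -/
theorem selmerCorank_eq_three_add_shaCorank_of_rank_eq_three (W : WeierstrassCurve ℚ) [W.IsElliptic]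
    (p : ℕ) [Fact p.Prime] (hr : W.mordellWeilRank = 3) : W.selmerCorank p = 3 + W.shaCorank p := by
  rw [← hr]; exact W.selmerCorank_eq_mordellWeilRank_add_holds p

/-- `corank Sel_{p^∞}(E/ℚ) ≥ 3` at every prime for a curve of rank `3` (hypothesis-free).
[cite: Greenberg1999LNM, §1 pp. 54–57] -/
theorem three_le_selmerCorank_of_rank_eq_three (W : WeierstrassCurve ℚ) [W.IsElliptic] (p : ℕ)
    [Fact p.Prime] (hr : W.mordellWeilRank = 3) : 3 ≤ W.selmerCorank p := by
  rw [selmerCorank_eq_three_add_shaCorank_of_rank_eq_three W p hr]; exact Nat.le_add_right 3 _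

/-- At rank `3`: `corank Sel_{p^∞} = 3 ↔ corank Ш[p^∞] = 0`. [cite: Greenberg1999LNM, §1 pp. 54–57] -/
theorem selmerCorank_eq_three_iff_shaCorank_eq_zero_of_rank_eq_three (W : WeierstrassCurve ℚ)
    [W.IsElliptic] (p : ℕ) [Fact p.Prime] (hr : W.mordellWeilRank = 3) :
    W.selmerCorank p = 3 ↔ W.shaCorank p = 0 := by
  rw [selmerCorank_eq_three_add_shaCorank_of_rank_eq_three W p hr]; omega

/-- At rank `3` (hypothesis-free): `Ш(E/ℚ)[p^∞]` is finite `↔ corank Sel_{p^∞}(E/ℚ) = 3` (`Ш[p]` is finite by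
weak Mordell–Weil, so corank `0` is finiteness). [cite: Greenberg1999LNM, §1 pp. 54–57] [cite: MilneADT2006, I.§6] -/
theorem finite_sha_primary_iff_selmerCorank_eq_three_of_rank_eq_three (W : WeierstrassCurve ℚ)
    [W.IsElliptic] (p : ℕ) [Fact p.Prime] (hr : W.mordellWeilRank = 3) :
    Finite (AddCommGroup.primaryComponent W.sha p) ↔ W.selmerCorank p = 3 := by
  rw [finite_primaryComponent_sha_iff_shaCorank_eq_zero W p,
    selmerCorank_eq_three_iff_shaCorank_eq_zero_of_rank_eq_three W p hr]

/-- **`p`-parity and sign `−1`**: `(−1)^{corank Sel_{p^∞}} = w(E) = −1` forces `corank Sel_{p^∞}(E/ℚ)` odd.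
[cite: DokchitserDokchitserAnnals2010, Thm. 1.4] -/
theorem odd_selmerCorank_of_p_parity_of_rootNumber_eq_neg_one (W : WeierstrassCurve ℚ) (p : ℕ)
    (hpp : p_parity W p) (hw : W.rootNumber = -1) : Odd (W.selmerCorank p) := by
  rcases Nat.even_or_odd (W.selmerCorank p) with h | h
  · exfalso
    unfold p_parity at hpp
    rw [hw, h.neg_one_pow] at hpp
    norm_num at hpp
  · exact h

/-- **The tree's analytic `p`-parity fact, discharged for sign `−1`**: `p`-parity and `w(E) = −1` give
`corank Sel_{p^∞}(E/ℚ) ≡ ord_{s=1} L(E,s) (mod 2)` (both odd; `ord` odd for sign `−1` unconditionally,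
`odd_analyticRank_of_rootNumber_eq_neg_one`). [cite: DokchitserDokchitserAnnals2010, Thm. 1.4]
[cite: SilvermanAEC2009, C.16 Thm. 16.3 and remark, p. 451] -/
theorem selmerCorank_mod_two_eq_of_p_parity_of_rootNumber_eq_neg_one (W : WeierstrassCurve ℚ)
    [W.IsElliptic] (p : ℕ) (hpp : p_parity W p) (hw : W.rootNumber = -1) : selmerCorank_mod_two_eq W p := by
  have h1 := odd_selmerCorank_of_p_parity_of_rootNumber_eq_neg_one W p hpp hw
  have h2 : Odd W.analyticRank := odd_analyticRank_of_rootNumber_eq_neg_one hw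
  unfold selmerCorank_mod_two_eq
  rw [Nat.odd_iff] at h1 h2
  omega

/-- **Ш-corank parity at rank 3**: `rank_ℤ E(ℚ) = 3`, `w(E) = −1` and `p`-parity give `corank_{ℤ_p} Ш(E/ℚ)[p^∞]`
EVEN (`3 + δ_p` odd). [cite: DokchitserDokchitserAnnals2010, Thm. 1.4] [cite: Dokchitser2013ParityNotes, §2 (p. 4)] -/
theorem even_shaCorank_of_rank_eq_three (W : WeierstrassCurve ℚ) [W.IsElliptic] (p : ℕ) [Fact p.Prime]
    (hr : W.mordellWeilRank = 3) (hpp : p_parity W p) (hw : W.rootNumber = -1) : Even (W.shaCorank p) := by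
  have h := odd_selmerCorank_of_p_parity_of_rootNumber_eq_neg_one W p hpp hw
  rw [selmerCorank_eq_three_add_shaCorank_of_rank_eq_three W p hr, Nat.odd_iff] at h
  rw [Nat.even_iff]; omega

/-- At rank `3`, sign `−1`, granting `p`-parity: **`Ш(E/ℚ)[p^∞]` is finite or has `ℤ_p`-corank `≥ 2`**.
[cite: DokchitserDokchitserAnnals2010, Thm. 1.4] [cite: Greenberg1999LNM, §1 pp. 54–57] -/
theorem finite_sha_primary_or_two_le_shaCorank_of_rank_eq_three (W : WeierstrassCurve ℚ) [W.IsElliptic]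
    (p : ℕ) [Fact p.Prime] (hr : W.mordellWeilRank = 3) (hpp : p_parity W p) (hw : W.rootNumber = -1) :
    Finite (AddCommGroup.primaryComponent W.sha p) ∨ 2 ≤ W.shaCorank p := by
  have h := even_shaCorank_of_rank_eq_three W p hr hpp hw
  rw [finite_primaryComponent_sha_iff_shaCorank_eq_zero W p, Nat.even_iff] at *
  omega

/-- **Algebraic decision window at rank 3** (sign `−1`, granting `p`-parity): `corank Sel_{p^∞}(E/ℚ) ≤ 4 ↔
corank Sel_{p^∞}(E/ℚ) = 3`. [cite: DokchitserDokchitserAnnals2010, Thm. 1.4] [cite: Greenberg1999LNM, §1 pp. 54–57] -/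
theorem selmerCorank_le_four_iff_eq_three_of_rank_eq_three (W : WeierstrassCurve ℚ) [W.IsElliptic]
    (p : ℕ) [Fact p.Prime] (hr : W.mordellWeilRank = 3) (hpp : p_parity W p) (hw : W.rootNumber = -1) :
    W.selmerCorank p ≤ 4 ↔ W.selmerCorank p = 3 := by
  have h1 := selmerCorank_eq_three_add_shaCorank_of_rank_eq_three W p hr
  have h2 := even_shaCorank_of_rank_eq_three W p hr hpp hw
  rw [Nat.even_iff] at h2
  omega

/-- **Algebraic decision window, finiteness form**: at rank `3`, sign `−1`, granting `p`-parity,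
`Ш(E/ℚ)[p^∞]` is finite `↔ corank Sel_{p^∞}(E/ℚ) ≤ 4`. [cite: DokchitserDokchitserAnnals2010, Thm. 1.4]
[cite: Greenberg1999LNM, §1 pp. 54–57] -/
theorem finite_sha_primary_iff_selmerCorank_le_four_of_rank_eq_three (W : WeierstrassCurve ℚ)
    [W.IsElliptic] (p : ℕ) [Fact p.Prime] (hr : W.mordellWeilRank = 3) (hpp : p_parity W p)
    (hw : W.rootNumber = -1) : Finite (AddCommGroup.primaryComponent W.sha p) ↔ W.selmerCorank p ≤ 4 := by
  rw [finite_sha_primary_iff_selmerCorank_eq_three_of_rank_eq_three W p hr,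
    selmerCorank_le_four_iff_eq_three_of_rank_eq_three W p hr hpp hw]

/-! ### §1 Per row of GRAND census N9375 (`hr : r ∈ Rank3KernelRankCensusN9375.rows`; `rank_ℤ = 3` in the kernel) -/

/-- **Per row, HYPOTHESIS-FREE**: `corank Sel_{p^∞}(E/ℚ) = 3 + corank Ш(E/ℚ)[p^∞]` at every prime `p`.
[cite: Greenberg1999LNM, §1 pp. 54–57] [cite: Cassels1991LecturesEllipticCurves, §15] -/
theorem Rank3Row.selmerCorank_eq_three_add_shaCorank_of_mem_rows9375 {r : Rank3Row}
    (hr : r ∈ Rank3KernelRankCensusN9375.rows) (p : ℕ) [Fact p.Prime] :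
    r.curve.selmerCorank p = 3 + r.curve.shaCorank p := by
  haveI := isElliptic_of_mem (mem_rows9375_iff.1 hr).1
  exact selmerCorank_eq_three_add_shaCorank_of_rank_eq_three r.curve p
    (Rank3KernelRankCensusN9375.rank_eq_three r hr)

/-- **Per row, HYPOTHESIS-FREE**: `corank Sel_{p^∞}(E/ℚ) ≥ 3` at every prime, and `Ш(E/ℚ)[p^∞]` is finite
`↔ corank Sel_{p^∞}(E/ℚ) = 3`. [cite: Greenberg1999LNM, §1 pp. 54–57] [cite: MilneADT2006, I.§6] -/
theorem Rank3Row.three_le_selmerCorank_and_finite_iff_of_mem_rows9375 {r : Rank3Row}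
    (hr : r ∈ Rank3KernelRankCensusN9375.rows) (p : ℕ) [Fact p.Prime] :
    3 ≤ r.curve.selmerCorank p ∧
      (Finite (AddCommGroup.primaryComponent r.curve.sha p) ↔ r.curve.selmerCorank p = 3) := by
  haveI := isElliptic_of_mem (mem_rows9375_iff.1 hr).1
  exact ⟨three_le_selmerCorank_of_rank_eq_three r.curve p (Rank3KernelRankCensusN9375.rank_eq_three r hr),
    finite_sha_primary_iff_selmerCorank_eq_three_of_rank_eq_three r.curve p
      (Rank3KernelRankCensusN9375.rank_eq_three r hr)⟩

/-- **Per row, granting `p`-parity (`hpp`) and the local-root-number facts (`hKD`, `hR`): `corank Sel_{p^∞}(E/ℚ)`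
is ODD and `corank Ш(E/ℚ)[p^∞]` is EVEN.** [cite: DokchitserDokchitserAnnals2010, Thm. 1.4]
[cite: KellockDokchitser2023, Thm. 2.3 and §5] [cite: Dokchitser2013ParityNotes, §2 (p. 4)] -/
theorem Rank3Row.odd_selmerCorank_and_even_shaCorank_of_mem_rows9375 {r : Rank3Row}
    (hr : r ∈ Rank3KernelRankCensusN9375.rows)
    (hKD : r.curve.rootNumber_eq_neg_finprod_tableLocalRootNumberAt')
    (hR : r.curve.rootNumber_eq_neg_finprod_fullTableLocalRootNumberAt) (p : ℕ) [Fact p.Prime]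
    (hpp : p_parity r.curve p) : Odd (r.curve.selmerCorank p) ∧ Even (r.curve.shaCorank p) := by
  haveI := isElliptic_of_mem (mem_rows9375_iff.1 hr).1
  have hw := Rank3Row.rootNumber_eq_neg_one_of_mem (mem_rows9375_iff.1 hr).1 hKD hR
  exact ⟨odd_selmerCorank_of_p_parity_of_rootNumber_eq_neg_one r.curve p hpp hw,
    even_shaCorank_of_rank_eq_three r.curve p (Rank3KernelRankCensusN9375.rank_eq_three r hr) hpp hw⟩

/-- **Per row, granting `p`-parity, `hKD`, `hR`: `Ш(E/ℚ)[p^∞]` is finite or has `ℤ_p`-corank `≥ 2`; and the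
ALGEBRAIC DECISION WINDOW `Ш(E/ℚ)[p^∞]` finite `↔ corank Sel_{p^∞}(E/ℚ) ≤ 4`.**
[cite: DokchitserDokchitserAnnals2010, Thm. 1.4] [cite: Greenberg1999LNM, §1 pp. 54–57] -/
theorem Rank3Row.sha_window_of_mem_rows9375 {r : Rank3Row} (hr : r ∈ Rank3KernelRankCensusN9375.rows)
    (hKD : r.curve.rootNumber_eq_neg_finprod_tableLocalRootNumberAt')
    (hR : r.curve.rootNumber_eq_neg_finprod_fullTableLocalRootNumberAt) (p : ℕ) [Fact p.Prime]
    (hpp : p_parity r.curve p) :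
    (Finite (AddCommGroup.primaryComponent r.curve.sha p) ∨ 2 ≤ r.curve.shaCorank p) ∧
      (Finite (AddCommGroup.primaryComponent r.curve.sha p) ↔ r.curve.selmerCorank p ≤ 4) := by
  haveI := isElliptic_of_mem (mem_rows9375_iff.1 hr).1
  have hw := Rank3Row.rootNumber_eq_neg_one_of_mem (mem_rows9375_iff.1 hr).1 hKD hR
  have h3 := Rank3KernelRankCensusN9375.rank_eq_three r hr
  exact ⟨finite_sha_primary_or_two_le_shaCorank_of_rank_eq_three r.curve p h3 hpp hw,
    finite_sha_primary_iff_selmerCorank_le_four_of_rank_eq_three r.curve p h3 hpp hw⟩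

/-- **Per row, granting `p`-parity, `hKD`, `hR`**: the tree's analytic `p`-parity fact
`selmerCorank_mod_two_eq E p` (`corank Sel_{p^∞} ≡ ord_{s=1} L(E,s) (mod 2)`) holds — no Gross–Zagier input.
[cite: DokchitserDokchitserAnnals2010, Thm. 1.4] [cite: SilvermanAEC2009, C.16 Thm. 16.3 and remark, p. 451] -/
theorem Rank3Row.selmerCorank_mod_two_eq_of_mem_rows9375 {r : Rank3Row}
    (hr : r ∈ Rank3KernelRankCensusN9375.rows)
    (hKD : r.curve.rootNumber_eq_neg_finprod_tableLocalRootNumberAt')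
    (hR : r.curve.rootNumber_eq_neg_finprod_fullTableLocalRootNumberAt) (p : ℕ)
    (hpp : p_parity r.curve p) : selmerCorank_mod_two_eq r.curve p := by
  haveI := isElliptic_of_mem (mem_rows9375_iff.1 hr).1
  exact selmerCorank_mod_two_eq_of_p_parity_of_rootNumber_eq_neg_one r.curve p hpp
    (Rank3Row.rootNumber_eq_neg_one_of_mem (mem_rows9375_iff.1 hr).1 hKD hR)

/-- **Per row, what the two clauses of full BSD say separately**: the summit statement (`hBSD`, rank part)
gives `ord_{s=1} L(E,s) = 3 ≤ corank Sel_{p^∞}(E/ℚ)` at every prime, with equality `↔ Ш(E/ℚ)[p^∞]` finite —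
the Shafarevich–Tate clause, which is not part of the summit statement and is not claimed.
[cite: Wiles2000, p. 2] [cite: Greenberg1999LNM, §1 pp. 54–57] -/
theorem Rank3Row.analyticRank_le_selmerCorank_of_bsd_of_mem_rows9375 {r : Rank3Row}
    (hr : r ∈ Rank3KernelRankCensusN9375.rows) (hBSD : _root_.BirchSwinnertonDyer) (p : ℕ) [Fact p.Prime] :
    r.curve.analyticRank ≤ r.curve.selmerCorank p ∧
      (r.curve.analyticRank = r.curve.selmerCorank p ↔
        Finite (AddCommGroup.primaryComponent r.curve.sha p)) := by
  obtain ⟨h3, hfin⟩ := Rank3Row.three_le_selmerCorank_and_finite_iff_of_mem_rows9375 hr p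
  rw [Rank3Row.analyticRank_eq_three_of_bsd_of_mem_rows9375 hr hBSD, hfin]
  exact ⟨h3, eq_comm⟩

/-! ### §1b Whole table (9 487 rows) granting `hup` for the 112 named residual rows -/

/-- Whole table, granting `hup` on the residual rows: `corank Sel_{p^∞} = 3 + corank Ш[p^∞]`, and
`Ш[p^∞]` finite `↔ corank Sel_{p^∞} = 3`. [cite: Greenberg1999LNM, §1 pp. 54–57] -/
theorem Rank3Row.selmerCorank_eq_three_add_shaCorank_of_mem_table112 {r : Rank3Row} (hr : r ∈ rank3Table)
    (hup : r ∈ residualRows112 → r.curve.mordellWeilRank ≤ 3) (p : ℕ) [Fact p.Prime] :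
    r.curve.selmerCorank p = 3 + r.curve.shaCorank p ∧
      (Finite (AddCommGroup.primaryComponent r.curve.sha p) ↔ r.curve.selmerCorank p = 3) := by
  haveI := isElliptic_of_mem hr
  exact ⟨selmerCorank_eq_three_add_shaCorank_of_rank_eq_three r.curve p (rank_eq_three_of_mem_rank3Table112 hr hup),
    finite_sha_primary_iff_selmerCorank_eq_three_of_rank_eq_three r.curve p
      (rank_eq_three_of_mem_rank3Table112 hr hup)⟩

/-- Whole table, granting `hup` on the residual rows, `p`-parity, `hKD`, `hR`: `corank Ш(E/ℚ)[p^∞]` is even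
and `Ш[p^∞]` finite `↔ corank Sel_{p^∞} ≤ 4`. [cite: DokchitserDokchitserAnnals2010, Thm. 1.4]
[cite: KellockDokchitser2023, Thm. 2.3 and §5] -/
theorem Rank3Row.even_shaCorank_and_window_of_mem_table112 {r : Rank3Row} (hr : r ∈ rank3Table)
    (hup : r ∈ residualRows112 → r.curve.mordellWeilRank ≤ 3)
    (hKD : r.curve.rootNumber_eq_neg_finprod_tableLocalRootNumberAt')
    (hR : r.curve.rootNumber_eq_neg_finprod_fullTableLocalRootNumberAt) (p : ℕ) [Fact p.Prime]
    (hpp : p_parity r.curve p) :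
    Even (r.curve.shaCorank p) ∧
      (Finite (AddCommGroup.primaryComponent r.curve.sha p) ↔ r.curve.selmerCorank p ≤ 4) := by
  haveI := isElliptic_of_mem hr
  have hw := Rank3Row.rootNumber_eq_neg_one_of_mem hr hKD hR
  exact ⟨even_shaCorank_of_rank_eq_three r.curve p (rank_eq_three_of_mem_rank3Table112 hr hup) hpp hw,
    finite_sha_primary_iff_selmerCorank_le_four_of_rank_eq_three r.curve p
      (rank_eq_three_of_mem_rank3Table112 hr hup) hpp hw⟩

/-! ### §2 Aggregated statements (9 375 pairwise distinct curves) -/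

/-- **HEADLINE, HYPOTHESIS-FREE — for 9 375 pairwise distinct elliptic curves over `ℚ` of conductor `< 5·10⁵`
and rank exactly `3`, at EVERY prime `p`: `corank_{ℤ_p} Sel_{p^∞}(E/ℚ) = 3 + corank_{ℤ_p} Ш(E/ℚ)[p^∞] ≥ 3`,
and `Ш(E/ℚ)[p^∞]` is finite iff `corank Sel_{p^∞}(E/ℚ) = 3`** (kernel rank certificates + the tree theorem
`selmerCorank_eq_mordellWeilRank_add_holds`). [cite: Greenberg1999LNM, §1 pp. 54–57]
[cite: Cassels1991LecturesEllipticCurves, §15] [cite: MilneADT2006, I.§6] -/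
theorem selmerCorank_rows9375 :
    ∃ l : List (WeierstrassCurve ℚ), l.Nodup ∧ l.length = 9375 ∧
      ∀ E ∈ l, E.IsElliptic ∧ E.conductorNorm ℤ < 500000 ∧ E.mordellWeilRank = 3 ∧
        ∀ (p : ℕ) [Fact p.Prime], E.selmerCorank p = 3 + E.shaCorank p ∧ 3 ≤ E.selmerCorank p ∧
          (Finite (AddCommGroup.primaryComponent E.sha p) ↔ E.selmerCorank p = 3) := by
  refine ⟨Rank3KernelRankCensusN9375.rows.map Rank3Row.curve, Rank3Joins112.rows9375_curves_nodup,
    by rw [List.length_map, Rank3KernelRankCensusN9375.rows_length], ?_⟩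
  intro E hE
  obtain ⟨r, hr, rfl⟩ := List.mem_map.1 hE
  have hrt : r ∈ rank3Table := (mem_rows9375_iff.1 hr).1
  refine ⟨isElliptic_of_mem hrt, Rank3Row.conductorNorm_lt_of_mem hrt,
    Rank3KernelRankCensusN9375.rank_eq_three r hr, fun p _ => ?_⟩
  exact ⟨Rank3Row.selmerCorank_eq_three_add_shaCorank_of_mem_rows9375 hr p,
    Rank3Row.three_le_selmerCorank_and_finite_iff_of_mem_rows9375 hr p⟩

/-- **HEADLINE — granting the `p`-parity theorem (`hDD`, Dokchitser–Dokchitser 2010 Thm. 1.4, for the curves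
of the table) and the named local-root-number facts (`hKD`, `hR`): for each of 9 375 pairwise distinct elliptic
curves over `ℚ` of conductor `< 5·10⁵` and rank exactly `3`, `w(E) = −1` and, at EVERY prime `p`,
`corank Sel_{p^∞}(E/ℚ)` is odd, `corank_{ℤ_p} Ш(E/ℚ)[p^∞]` is EVEN — `Ш(E/ℚ)[p^∞]` is finite or of corank
`≥ 2` —, `Ш(E/ℚ)[p^∞]` is finite iff `corank Sel_{p^∞}(E/ℚ) ≤ 4`, and `corank Sel_{p^∞} ≡ ord_{s=1} L (mod 2)`.**
No Gross–Zagier input, no numerics. [cite: DokchitserDokchitserAnnals2010, Thm. 1.4]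
[cite: KellockDokchitser2023, Thm. 2.3 and §5] [cite: Dokchitser2013ParityNotes, §2 (p. 4)]
[cite: Greenberg1999LNM, §1 pp. 54–57] -/
theorem shaCorank_parity_rows9375
    (hKD : ∀ r ∈ rank3Table, r.curve.rootNumber_eq_neg_finprod_tableLocalRootNumberAt')
    (hR : ∀ r ∈ rank3Table, r.curve.rootNumber_eq_neg_finprod_fullTableLocalRootNumberAt)
    (hDD : ∀ r ∈ rank3Table, ∀ p : ℕ, p.Prime → p_parity r.curve p) :
    ∃ l : List (WeierstrassCurve ℚ), l.Nodup ∧ l.length = 9375 ∧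
      ∀ E ∈ l, E.IsElliptic ∧ E.conductorNorm ℤ < 500000 ∧ E.mordellWeilRank = 3 ∧ E.rootNumber = -1 ∧
        ∀ (p : ℕ) [Fact p.Prime], Odd (E.selmerCorank p) ∧ Even (E.shaCorank p) ∧
          (Finite (AddCommGroup.primaryComponent E.sha p) ∨ 2 ≤ E.shaCorank p) ∧
          (Finite (AddCommGroup.primaryComponent E.sha p) ↔ E.selmerCorank p ≤ 4) ∧
          selmerCorank_mod_two_eq E p := by
  refine ⟨Rank3KernelRankCensusN9375.rows.map Rank3Row.curve, Rank3Joins112.rows9375_curves_nodup,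
    by rw [List.length_map, Rank3KernelRankCensusN9375.rows_length], ?_⟩
  intro E hE
  obtain ⟨r, hr, rfl⟩ := List.mem_map.1 hE
  have hrt : r ∈ rank3Table := (mem_rows9375_iff.1 hr).1
  refine ⟨isElliptic_of_mem hrt, Rank3Row.conductorNorm_lt_of_mem hrt,
    Rank3KernelRankCensusN9375.rank_eq_three r hr,
    Rank3Row.rootNumber_eq_neg_one_of_mem hrt (hKD r hrt) (hR r hrt), fun p hp => ?_⟩
  have hpp : p_parity r.curve p := hDD r hrt p hp.out
  exact ⟨(Rank3Row.odd_selmerCorank_and_even_shaCorank_of_mem_rows9375 hr (hKD r hrt) (hR r hrt) p hpp).1,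
    (Rank3Row.odd_selmerCorank_and_even_shaCorank_of_mem_rows9375 hr (hKD r hrt) (hR r hrt) p hpp).2,
    (Rank3Row.sha_window_of_mem_rows9375 hr (hKD r hrt) (hR r hrt) p hpp).1,
    (Rank3Row.sha_window_of_mem_rows9375 hr (hKD r hrt) (hR r hrt) p hpp).2,
    Rank3Row.selmerCorank_mod_two_eq_of_mem_rows9375 hr (hKD r hrt) (hR r hrt) p hpp⟩

/-- Row form of the headline: on every row of N9375 and at every prime, `corank Ш(E/ℚ)[p^∞]` is even
(granting `hKD`, `hR`, `hDD`). [cite: DokchitserDokchitserAnnals2010, Thm. 1.4] [cite: KellockDokchitser2023, Thm. 2.3 and §5] -/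
theorem forall_rows9375_even_shaCorank
    (hKD : ∀ r ∈ rank3Table, r.curve.rootNumber_eq_neg_finprod_tableLocalRootNumberAt')
    (hR : ∀ r ∈ rank3Table, r.curve.rootNumber_eq_neg_finprod_fullTableLocalRootNumberAt)
    (hDD : ∀ r ∈ rank3Table, ∀ p : ℕ, p.Prime → p_parity r.curve p) :
    ∀ r ∈ Rank3KernelRankCensusN9375.rows, ∀ (p : ℕ) [Fact p.Prime], Even (r.curve.shaCorank p) :=
  fun r hr p hp =>
    (Rank3Row.odd_selmerCorank_and_even_shaCorank_of_mem_rows9375 hr (hKD r (mem_rows9375_iff.1 hr).1)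
      (hR r (mem_rows9375_iff.1 hr).1) p (hDD r (mem_rows9375_iff.1 hr).1 p hp.out)).2

/-! ### §3 Row `0` by name: `Curve5077a.E = 5077a1 = [0,0,1,-7,6]` -/

/-- **5077a1, HYPOTHESIS-FREE**: `corank Sel_{p^∞}(E/ℚ) = 3 + corank Ш(E/ℚ)[p^∞]` at every prime, and
`Ш(E/ℚ)[p^∞]` is finite `↔ corank Sel_{p^∞}(E/ℚ) = 3` (`rank_ℤ = 3` by name, `curve5077a_mordellWeilRank_eq_three`).
[cite: Greenberg1999LNM, §1 pp. 54–57] [cite: BuhlerGrossZagier1985, §3 (p. 479)] -/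
theorem curve5077a_selmerCorank_eq_three_add_shaCorank (p : ℕ) [Fact p.Prime] :
    Curve5077a.E.selmerCorank p = 3 + Curve5077a.E.shaCorank p ∧
      (Finite (AddCommGroup.primaryComponent Curve5077a.E.sha p) ↔ Curve5077a.E.selmerCorank p = 3) :=
  ⟨selmerCorank_eq_three_add_shaCorank_of_rank_eq_three _ p curve5077a_mordellWeilRank_eq_three,
    finite_sha_primary_iff_selmerCorank_eq_three_of_rank_eq_three _ p curve5077a_mordellWeilRank_eq_three⟩

/-- **5077a1, granting Modularity (`hmod`: the sign `w(E) = −1` is `Curve5077a.rootNumber_E`) and `p`-parity at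
`p`**: `corank Sel_{p^∞}(E/ℚ)` is odd, `corank_{ℤ_p} Ш(E/ℚ)[p^∞]` is EVEN, `Ш(E/ℚ)[p^∞]` is finite
`↔ corank Sel_{p^∞}(E/ℚ) ≤ 4`, and `corank Sel_{p^∞} ≡ ord_{s=1} L(E,s) (mod 2)` — nothing here decides whether
`Ш(5077a1)` is finite. [cite: DokchitserDokchitserAnnals2010, Thm. 1.4] [cite: BuhlerGrossZagier1985, §3 (p. 479)] -/
theorem curve5077a_shaCorank_parity (hmod : exists_isNewformOf) (p : ℕ) [Fact p.Prime]
    (hpp : p_parity Curve5077a.E p) :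
    Odd (Curve5077a.E.selmerCorank p) ∧ Even (Curve5077a.E.shaCorank p) ∧
      (Finite (AddCommGroup.primaryComponent Curve5077a.E.sha p) ↔ Curve5077a.E.selmerCorank p ≤ 4) ∧
      selmerCorank_mod_two_eq Curve5077a.E p :=
  ⟨odd_selmerCorank_of_p_parity_of_rootNumber_eq_neg_one _ p hpp (Curve5077a.rootNumber_E hmod),
    even_shaCorank_of_rank_eq_three _ p curve5077a_mordellWeilRank_eq_three hpp (Curve5077a.rootNumber_E hmod),
    finite_sha_primary_iff_selmerCorank_le_four_of_rank_eq_three _ p curve5077a_mordellWeilRank_eq_three hpp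
      (Curve5077a.rootNumber_E hmod),
    selmerCorank_mod_two_eq_of_p_parity_of_rootNumber_eq_neg_one _ p hpp (Curve5077a.rootNumber_E hmod)⟩

/-- Row `0` of the table (`= Curve5077a.E` by `rfl`, `curve_row0_eq`): `corank Ш[p^∞]` even at every prime,
granting `hmod` and `p`-parity. [cite: DokchitserDokchitserAnnals2010, Thm. 1.4] -/
theorem even_shaCorank_row0 (hmod : exists_isNewformOf) (p : ℕ) [Fact p.Prime]
    (hpp : p_parity (rank3Table[0]'(by rw [rank3Table_length]; decide)).curve p) :
    Even ((rank3Table[0]'(by rw [rank3Table_length]; decide)).curve.shaCorank p) := by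
  rw [curve_row0_eq] at hpp ⊢; exact (curve5077a_shaCorank_parity hmod p hpp).2.1

end Summit.BirchSwinnertonDyer.BirchSwinnertonDyer.Rank2Observatory
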